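import Mathlib.Topology.Instances.ZMod
import Mathlib.Analysis.Complex.Basic
import Literature.NumberTheory.GaloisRepresentations.GaloisCohomology
import HarnessLib

/-!
# The Kummer sign character `χ_a : Gal(K̄/F) → {±1}` of a square root, and its value at a complex
# conjugation

Let `K` be a field of characteristic `0`, `K̄ = AlgebraicClosure K`, `Γ_K = Gal(K̄/K)`, and let
`a ∈ K̄`, `a ≠ 0`, be fixed by a subgroup `N ≤ Γ_K` (i.e. `a` lies in the fixed field `F = K̄^N`).
Choosing a square root `α`, `α² = a`, every `n ∈ N` satisfies `n α = ± α`, and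
`χ_a(n) = (n α)/α ∈ {±1} = ℤ/2` is the **Kummer character** of `a` — the image of `a` under
`F^×/F^{×2} = H¹(F, μ₂) = Hom_cont(Gal(K̄/F), ℤ/2)` (Kummer theory in degree `2`; Serre, *Corps locaux*
X §3 (b); Milne, *Fields and Galois Theory* §5 "Kummer theory"; Neukirch–Schmidt–Wingberg (1.6.?)…).
It does not depend on the choice of `α`, is a continuous homomorphism (Krull topology: the stabiliser of
`α` is open), and — the point used by the tree — **at a complex conjugation it reads the SIGN of `a`**:
if `τ ∈ N` and `ι : K̄ → ℂ` is an embedding with `ι ∘ τ = conj ∘ ι`, then `ι a ∈ ℝ` and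
`χ_a(τ) = -1 ⟺ ι a < 0` (`ι α` is real iff `ι a > 0`).

* `kummerSign a ha N hN : N →* Multiplicative (ZMod 2)` — definition with body (a chosen square root
  `kummerSqrt a`, `kummerSqrt_mul_self`);
* `smul_kummerSqrt_eq_or` (`n α = α ∨ n α = -α`), `kummerSign_eq_one_iff` (`χ_a n = 1 ↔ n α = α`);
* `continuous_kummerSign`;
* `kummerSign_toAdd_eq_one_iff_re_lt_zero`, `kummerSign_toAdd_eq_zero_iff_re_pos` — the sign reading at
  a complex conjugation `τ` along `ι`.

Consumer: the real-place surjectivity `H²(K, M) ↠ ⊕_{v real} H²(K_v, M)` (Milne I Cor. 4.16),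
`GaloisCohomology/PoitouTateTwoRealPlacesSurjectiveHolds.lean` (the character twisting the carry
cocycle of `ContinuousCarryTwoCocycle.lean`).

## References

* J.-P. Serre, *Corps locaux* (1968) / *Local Fields* (1979), X §3 (Kummer theory). [SerreLocalFields1979]
* J. S. Milne, *Arithmetic Duality Theorems*, 2nd ed. (2006), I §4 (archimedean components).
  [MilneADT2006]
-/

noncomputable section

open Field Topology

universe u

namespace Literature.NumberTheory.GaloisRepresentations

variable {K : Type u} [Field K]

/-! ### A square root and the dichotomy `n α = ± α` -/

/-- A chosen square root `α` of `a ∈ K̄` (`α * α = a`; `K̄` is algebraically closed).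
[cite: SerreLocalFields1979, X §3] -/
def kummerSqrt (a : AlgebraicClosure K) : AlgebraicClosure K :=
  (IsAlgClosed.exists_eq_mul_self a).choose

/-- `kummerSqrt a * kummerSqrt a = a`. [cite: SerreLocalFields1979, X §3] -/
theorem kummerSqrt_mul_self (a : AlgebraicClosure K) : kummerSqrt a * kummerSqrt a = a :=
  (IsAlgClosed.exists_eq_mul_self a).choose_spec.symm

/-- `kummerSqrt a ≠ 0` for `a ≠ 0`. [cite: SerreLocalFields1979, X §3] -/
theorem kummerSqrt_ne_zero {a : AlgebraicClosure K} (ha : a ≠ 0) : kummerSqrt a ≠ 0 := by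
  intro h
  apply ha
  rw [← kummerSqrt_mul_self a, h, mul_zero]

/-- **`n α = α` or `n α = -α`** for `n ∈ Γ_K` fixing `a = α²`. [cite: SerreLocalFields1979, X §3] -/
theorem smul_kummerSqrt_eq_or {a : AlgebraicClosure K} (n : absoluteGaloisGroup K) (hn : n • a = a) :
    n • kummerSqrt a = kummerSqrt a ∨ n • kummerSqrt a = -kummerSqrt a := by
  have h : (n • kummerSqrt a) * (n • kummerSqrt a) = kummerSqrt a * kummerSqrt a := by
    rw [← smul_mul', kummerSqrt_mul_self, hn]
  exact mul_self_eq_mul_self_iff.mp h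

variable [CharZero K]

/-- In characteristic `0`, `α ≠ -α` for `α ≠ 0`. (Auxiliary.) [cite: SerreLocalFields1979, X §3] -/
theorem kummerSqrt_ne_neg {a : AlgebraicClosure K} (ha : a ≠ 0) : kummerSqrt a ≠ -kummerSqrt a := by
  intro h
  have h2 : (2 : AlgebraicClosure K) * kummerSqrt a = 0 := by linear_combination h
  rcases mul_eq_zero.mp h2 with h0 | h0
  · exact two_ne_zero h0
  · exact kummerSqrt_ne_zero ha h0

/-! ### The character -/

section Character

variable (a : AlgebraicClosure K) (ha : a ≠ 0) (N : Subgroup (absoluteGaloisGroup K))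
  (hN : ∀ n ∈ N, n • a = a)

open scoped Classical in
/-- **The Kummer sign character** `χ_a : N → {±1} = Multiplicative (ZMod 2)` of `a ∈ K̄^N`, `a ≠ 0`:
`χ_a(n) = 1` if `n α = α` and `χ_a(n) = -1` (written `ofAdd 1`) if `n α = -α`, for the chosen square
root `α = kummerSqrt a`.  A group homomorphism (the Kummer class of `a` in
`H¹(K̄^N, μ₂) = Hom(N, ℤ/2)`). [cite: SerreLocalFields1979, X §3] -/
def kummerSign : N →* Multiplicative (ZMod 2) where
  toFun n := if (n : absoluteGaloisGroup K) • kummerSqrt a = kummerSqrt a then 1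
    else Multiplicative.ofAdd 1
  map_one' := by rw [if_pos (by rw [Subgroup.coe_one, one_smul])]
  map_mul' n₁ n₂ := by
    have hne := kummerSqrt_ne_neg ha
    have h11 : (Multiplicative.ofAdd (1 : ZMod 2)) * Multiplicative.ofAdd (1 : ZMod 2) = 1 := by
      rw [← ofAdd_add]; decide
    rcases smul_kummerSqrt_eq_or (n₂ : absoluteGaloisGroup K) (hN _ n₂.2) with h₂ | h₂ <;>
      rcases smul_kummerSqrt_eq_or (n₁ : absoluteGaloisGroup K) (hN _ n₁.2) with h₁ | h₁
    · rw [if_pos h₁, if_pos h₂, if_pos (by rw [Subgroup.coe_mul, mul_smul, h₂, h₁]), one_mul]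
    · have h : ¬ ((n₁ * n₂ : N) : absoluteGaloisGroup K) • kummerSqrt a = kummerSqrt a := by
        rw [Subgroup.coe_mul, mul_smul, h₂, h₁]; exact fun h => hne h.symm
      have h₁' : ¬ (n₁ : absoluteGaloisGroup K) • kummerSqrt a = kummerSqrt a :=
        fun h' => hne (h'.symm.trans h₁)
      rw [if_neg h₁', if_pos h₂, if_neg h, mul_one]
    · have h : ¬ ((n₁ * n₂ : N) : absoluteGaloisGroup K) • kummerSqrt a = kummerSqrt a := by
        rw [Subgroup.coe_mul, mul_smul, h₂, smul_neg, h₁]; exact fun h => hne h.symm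
      have h₂' : ¬ (n₂ : absoluteGaloisGroup K) • kummerSqrt a = kummerSqrt a :=
        fun h' => hne (h'.symm.trans h₂)
      rw [if_pos h₁, if_neg h₂', if_neg h, one_mul]
    · have h : ((n₁ * n₂ : N) : absoluteGaloisGroup K) • kummerSqrt a = kummerSqrt a := by
        rw [Subgroup.coe_mul, mul_smul, h₂, smul_neg, h₁, neg_neg]
      have h₁' : ¬ (n₁ : absoluteGaloisGroup K) • kummerSqrt a = kummerSqrt a :=
        fun h' => hne (h'.symm.trans h₁)
      have h₂' : ¬ (n₂ : absoluteGaloisGroup K) • kummerSqrt a = kummerSqrt a :=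
        fun h' => hne (h'.symm.trans h₂)
      rw [if_neg h₁', if_neg h₂', if_pos h, h11]

/-- **`χ_a(n) = 1 ↔ n α = α`.** [cite: SerreLocalFields1979, X §3] -/
theorem kummerSign_eq_one_iff (n : N) :
    kummerSign a ha N hN n = 1 ↔ (n : absoluteGaloisGroup K) • kummerSqrt a = kummerSqrt a := by
  classical
  change (if (n : absoluteGaloisGroup K) • kummerSqrt a = kummerSqrt a then (1 : Multiplicative (ZMod 2))
    else Multiplicative.ofAdd 1) = 1 ↔ _
  constructor
  · intro h
    by_contra hn
    rw [if_neg hn] at h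
    exact absurd (congrArg Multiplicative.toAdd h) (by decide)
  · intro h
    rw [if_pos h]

/-- The values of `χ_a` read in `ℤ/2`: `toAdd (χ_a n) = 0 ↔ n α = α`. [cite: SerreLocalFields1979, X §3] -/
theorem toAdd_kummerSign_eq_zero_iff (n : N) :
    Multiplicative.toAdd (kummerSign a ha N hN n) = 0 ↔
      (n : absoluteGaloisGroup K) • kummerSqrt a = kummerSqrt a := by
  rw [← kummerSign_eq_one_iff a ha N hN n]
  constructor
  · intro h
    exact Multiplicative.toAdd.injective (by rw [h, toAdd_one])
  · intro h
    rw [h, toAdd_one]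

/-- The values of `χ_a` read in `ℤ/2`: `toAdd (χ_a n) = 1 ↔ n α = -α`. [cite: SerreLocalFields1979, X §3] -/
theorem toAdd_kummerSign_eq_one_iff (n : N) :
    Multiplicative.toAdd (kummerSign a ha N hN n) = 1 ↔
      (n : absoluteGaloisGroup K) • kummerSqrt a = -kummerSqrt a := by
  have hne := kummerSqrt_ne_neg ha
  have h01 : ∀ z : ZMod 2, z = 1 ↔ ¬ z = 0 := by decide
  rw [h01, toAdd_kummerSign_eq_zero_iff]
  constructor
  · intro h
    rcases smul_kummerSqrt_eq_or (n : absoluteGaloisGroup K) (hN _ n.2) with h' | h'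
    · exact absurd h' h
    · exact h'
  · intro h h'
    exact hne (h'.symm.trans h)

/-- **`χ_a` is continuous** (Krull topology on `N ≤ Γ_K`, discrete on `ℤ/2`): it is `1` on the open
stabiliser of `α`. [cite: SerreLocalFields1979, X §3] -/
theorem continuous_kummerSign : Continuous (kummerSign a ha N hN) := by
  refine continuous_of_continuousAt_one (kummerSign a ha N hN) ?_
  rw [ContinuousAt, map_one]
  have hmem : {n : N | (n : absoluteGaloisGroup K) • kummerSqrt a = kummerSqrt a} ∈ 𝓝 (1 : N) := by
    have h := setOf_smul_eq_mem_nhds_one K (kummerSqrt a)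
    exact (continuous_subtype_val.tendsto (1 : N)) h
  refine tendsto_nhds.2 fun U _ hU => Filter.mem_of_superset hmem fun n hn => ?_
  change kummerSign a ha N hN n ∈ U
  rwa [(kummerSign_eq_one_iff a ha N hN n).2 hn]

/-! ### The value at a complex conjugation -/

/-- **At a complex conjugation the Kummer character reads the sign.**  Let `τ ∈ N` and let
`ι : K̄ → ℂ` be an embedding under which `τ` acts as complex conjugation (`ι (τ z) = conj (ι z)`).
Then `ι a` is real (`a` is `τ`-fixed) and **`χ_a(τ) = -1` (i.e. `toAdd (χ_a τ) = 1`) iff `ι a < 0`**: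
`ι α` is a square root of `ι a`, and `τ α = α` iff `ι α` is real iff `ι a > 0`.
[cite: MilneADT2006, Ch. I §4 (p. 55)] [cite: SerreLocalFields1979, X §3] -/
theorem toAdd_kummerSign_eq_one_iff_re_lt_zero (τ : N) (ι : AlgebraicClosure K →+* ℂ)
    (hι : ∀ z : AlgebraicClosure K, ι ((τ : absoluteGaloisGroup K) • z) = starRingEnd ℂ (ι z)) :
    Multiplicative.toAdd (kummerSign a ha N hN τ) = 1 ↔ (ι a).re < 0 := by
  set z : ℂ := ι (kummerSqrt a) with hz
  have hza : z * z = ι a := by rw [hz, ← map_mul, kummerSqrt_mul_self]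
  have hz0 : z ≠ 0 := by
    rw [hz]
    exact (map_ne_zero ι).2 (kummerSqrt_ne_zero ha)
  rw [toAdd_kummerSign_eq_one_iff]
  constructor
  · intro h
    -- `conj z = -z`: `z` is purely imaginary, `ι a = z² < 0`
    have hconj : starRingEnd ℂ z = -z := by rw [hz, ← hι, h, map_neg]
    have hre : z.re = 0 := by
      have := congrArg Complex.re hconj
      simp only [Complex.conj_re, Complex.neg_re] at this
      linarith
    have him : z.im ≠ 0 := fun him => hz0 (Complex.ext hre him)
    rw [← hza, Complex.mul_re, hre]
    nlinarith [sq_pos_of_ne_zero him]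
  · intro h
    rcases smul_kummerSqrt_eq_or (τ : absoluteGaloisGroup K) (hN _ τ.2) with h' | h'
    · -- `conj z = z`: `z` real, `ι a = z² ≥ 0`, contradiction
      exfalso
      have hconj : starRingEnd ℂ z = z := by rw [hz, ← hι, h']
      have him : z.im = 0 := by
        have := congrArg Complex.im hconj
        simp only [Complex.conj_im] at this
        linarith
      have hre : (ι a).re = z.re * z.re := by rw [← hza, Complex.mul_re, him, mul_zero, sub_zero]
      nlinarith [mul_self_nonneg z.re]
    · exact h'

/-- Companion reading: **`χ_a(τ) = 1` (i.e. `toAdd (χ_a τ) = 0`) iff `ι a > 0`** at a complex conjugation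
`τ` along `ι` (`ι a` is real and non-zero). [cite: MilneADT2006, Ch. I §4 (p. 55)] [cite: SerreLocalFields1979, X §3] -/
theorem toAdd_kummerSign_eq_zero_iff_re_pos (τ : N) (ι : AlgebraicClosure K →+* ℂ)
    (hι : ∀ z : AlgebraicClosure K, ι ((τ : absoluteGaloisGroup K) • z) = starRingEnd ℂ (ι z)) :
    Multiplicative.toAdd (kummerSign a ha N hN τ) = 0 ↔ 0 < (ι a).re := by
  set z : ℂ := ι (kummerSqrt a) with hz
  have hza : z * z = ι a := by rw [hz, ← map_mul, kummerSqrt_mul_self]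
  have hz0 : z ≠ 0 := by
    rw [hz]
    exact (map_ne_zero ι).2 (kummerSqrt_ne_zero ha)
  have h01 : ∀ u : ZMod 2, u = 0 ↔ ¬ u = 1 := by decide
  rw [h01, toAdd_kummerSign_eq_one_iff_re_lt_zero a ha N hN τ ι hι, not_lt]
  -- `ι a` is real and non-zero, so `0 ≤ re ↔ 0 < re`
  have hreal : (ι a).im = 0 := by
    have hfix : ι ((τ : absoluteGaloisGroup K) • a) = ι a := by rw [hN _ τ.2]
    rw [hι] at hfix
    have := congrArg Complex.im hfix
    simp only [Complex.conj_im] at this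
    linarith
  have hne : (ι a).re ≠ 0 := by
    intro hre
    have : ι a = 0 := Complex.ext hre hreal
    exact (map_ne_zero ι).2 ha this
  constructor
  · intro h
    exact lt_of_le_of_ne h (Ne.symm hne)
  · exact le_of_lt

end Character

end Literature.NumberTheory.GaloisRepresentations

end
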